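import Mathlib.Analysis.Normed.Module.Connected
import Mathlib.Analysis.Normed.Module.Convex
import Mathlib.Topology.Connected.LocallyPathConnected
import Literature.Topology.FourManifolds.LinkingNumber
import Literature.Topology.FourManifolds.KnotGroup
import Literature.Topology.FourManifolds.DehnSurgeryTubularNbhdProofs
import Literature.Topology.FourManifolds.GluckTwistSimplyConnected
import HarnessLib

/-!
# Linking numbers: proofs (bounding discs; connectedness of knot complements)

Sibling proof file of `Literature.Topology.FourManifolds.LinkingNumber` (D-0014: named facts
`def X : Prop` are discharged as `theorem X_holds : X`). It discharges

* `Literature.Knot.hasLinkingNumber_zero_of_exists_disc_holds : Knot.hasLinkingNumber_zero_of_exists_disc`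
  — a knot `J` bounding a (singular) disc in `S³ ∖ K` has `lk(K, J) = 0` (Rolfsen, *Knots and
  Links* (1976), §5.D: with definition (2) of the linking number, `lk(K, J) = [J] ∈ H₁(S³ ∖ K)`,
  such a `J` is null-homotopic, hence null-homologous, in `S³ ∖ K`);

and, on the way, the named fact of `Literature.Topology.FourManifolds.KnotGroup`

* `Literature.Knot.pathConnectedSpace_complement_holds : Knot.pathConnectedSpace_complement` — the
  complement of a knot in `S³` is path connected (Rolfsen (1976), §3.A);

and the smoothness fact of `LinkingNumber` consumed by the construction `Knot.TubularNbhd.pushOff`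

* `Literature.Topology.FourManifolds.Knot.TubularNbhd.isSmoothEmbedding_pushOff_holds :
  Knot.TubularNbhd.isSmoothEmbedding_pushOff` — the push-off `x ↦ ν (x, e₀)` of a knot along an
  oriented tubular neighbourhood `ν : S¹ × ℝ² → S³` is a smooth embedding `S¹ → S³` (Hirsch,
  *Differential Topology* (1976), Ch. 1 §3: an embedding is an immersion mapping its domain
  homeomorphically onto its image; with Ch. 1 §2, `T(g ∘ f) = Tg ∘ Tf`, the composition of the
  embedding `ν` with the embedded slice `x ↦ (x, e₀)` is again one); users of the class
  `Knot.TubularNbhd.SmoothnessFacts` (`pushOff`, `FramedLink.IsHandleSlide`, `KirbyMove`, …) can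
  feed it `⟨Knot.TubularNbhd.isSmoothEmbedding_pushOff_holds⟩` (see the section *The push-off is
  a smooth embedding* below for the proof).

## Proof

The conclusion `K.HasLinkingNumber J h 0` unfolds to
`∃ (ν : Knot.TubularNbhd K) (γ : Path ν.basePoint (J (1, 0))), [γ · J · γ⁻¹]ᵃᵇ = [meridian ν] ^ 0`
in `π₁(S³ ∖ K, ν.basePoint)ᵃᵇ`. Three inputs:

1. *Some* oriented tubular neighbourhood `ν` of `K`: the tubular neighbourhood theorem
   `Literature.Topology.FourManifolds.Knot.nonempty_tubularNbhd_holds` (`DehnSurgeryTubularNbhdProofs`; Hirsch (1976), §4.5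
   Thm 5.2).
2. *Some* path `γ` in `S³ ∖ K` from `ν.basePoint` to `J (1, 0)`: **`S³ ∖ K` is path connected**
   (`Literature.Topology.FourManifolds.Knot.TubularNbhd.isPathConnected_compl_range`): `S³ = (S³ ∖ K) ∪ ν(S¹ × ℝ²)` is a cover
   by two open sets (invariance of domain for the equidimensional embedding `ν`,
   `Manifold.IsSmoothEmbedding.isOpenMap_of_finrank_eq` of `GluckTwistProofs`) whose
   intersection `ν(S¹ × (ℝ² ∖ 0))` is connected, so `S³ ∖ K` is connected
   (`IsPreconnected.of_isOpen_cover` of `GluckTwistSimplyConnected`, the same argument as for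
   2-knots there), and it is open in the locally path connected `S³`.
3. The null-homotopy (`Literature.Topology.FourManifolds.Knot.homotopic_loopInCompl_refl`): if `f : ℝ² → S³` is continuous on
   the closed unit disc, restricts to `J` on the unit circle and misses `K` on the disc, then
   `(s, θ) ↦ f ((1 - s) e^{2πiθ} + s · 1)` — `f` composed with the straight-line homotopy inside the
   convex disc — contracts the loop of `J` in `S³ ∖ K` rel base point. Hence for **every** `ν`, `γ`
   the loop `γ · J · γ⁻¹ ≃ γ · γ⁻¹ ≃ const` has trivial class
   (`Literature.Topology.FourManifolds.Knot.HasLinkingNumber.of_homotopic_refl`), which is `[meridian] ^ 0`.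

## Proof of the smoothness of the push-off

Mathlib's `Manifold.IsSmoothEmbedding.comp` is still a `proof_wanted`, but here
`dim (S¹ × ℝ²) = dim S³ = 3`: the tubular neighbourhood `ν` is an *open* smooth embedding
(`Knot.TubularNbhd.isOpen_range`, invariance of domain) whose inverse is smooth on the open tube
(`Literature.Topology.FourManifolds.contMDiffOn_symm_of_isSmoothEmbedding`), so the recentred map
`Φ : (x, w) ↦ ν (x, w + e₀)` is a partial diffeomorphism `S¹ × ℝ² ⇀ S³` whose zero section is the
push-off; the tree's zero-section criterion
`Literature.Topology.FourManifolds.isImmersionAtOfComplement_of_eventuallyEq_prod`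
(`SmoothEmbeddingCriteria`) then exhibits the push-off as an immersion with complement `ℝ²` in the
charts `chartAt x` and `Φ.symm ≫ chartAt (x, 0) ≫ (ℝ¹ × ℝ² ≃L ℝ³)`, and a continuous injection of
the compact `S¹` into the Hausdorff `S³` is a topological embedding.

## Sources

* D. Rolfsen, *Knots and Links*, Publish or Perish (1976), §5.D (linking number, definition (2)),
  §3.A (knot complements), §9.F (longitudes / push-offs).
* M. W. Hirsch, *Differential Topology*, Springer GTM 33 (1976), Ch. 1 §2 (`T(g ∘ f) = Tg ∘ Tf`),
  Ch. 1 §3 (immersions, embeddings; Thm. 3.1), §4.5 Thm 5.2 (tubular neighbourhoods).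

No local notation is declared: `EuclideanSpace ℝ (Fin n)` and
`Metric.sphere (0 : EuclideanSpace ℝ (Fin (n + 1))) 1` are written out (they are the `𝔼 n`, `𝕊 n`
of `LinkingNumber`).
-/

open scoped Manifold ContDiff Topology
open Function Set Filter

noncomputable section

namespace Literature.Topology.FourManifolds

/-- `ℝⁿ` has dimension `> 1` for `n > 1` (rank form, as consumed by Mathlib's connectedness
lemmas `isPreconnected_sphere`, `isConnected_compl_singleton_of_one_lt_rank`). [folklore] -/
theorem one_lt_rank_euclideanSpace {n : ℕ} (hn : 1 < n) :
    1 < Module.rank ℝ (EuclideanSpace ℝ (Fin n)) := by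
  rw [← Module.finrank_eq_rank, finrank_euclideanSpace_fin]
  exact_mod_cast hn

/-! ### Knot complements are path connected -/

namespace Knot.TubularNbhd

variable {K : Knot}

/-- **A tubular neighbourhood is open**: the image `ν (S¹ × ℝ²)` of an oriented tubular
neighbourhood of a knot is an open subset of `S³`, by invariance of domain for the equidimensional
(`1 + 2 = 3`) smooth embedding `ν` (`Manifold.IsSmoothEmbedding.isOpenMap_of_finrank_eq`).
Hirsch (1976), §4.5 (a tubular neighbourhood is a neighbourhood). [cite: Hirsch1976, §4.5] -/
theorem isOpen_range (ν : Knot.TubularNbhd K) : IsOpen (range ⇑ν) :=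
  (Manifold.IsSmoothEmbedding.isOpenMap_of_finrank_eq ν.isSmoothEmbedding_coe
    (by simp)).isOpen_range

/-- Off the knot, the tubular neighbourhood consists of the images of the nonzero normal vectors:
`(S³ ∖ K) ∩ ν (S¹ × ℝ²) = ν (S¹ × (ℝ² ∖ 0))`. [folklore] -/
theorem compl_range_inter_range (ν : Knot.TubularNbhd K) :
    (range ⇑K)ᶜ ∩ range ⇑ν = ⇑ν '' {q | q.2 ≠ 0} := by
  ext p
  constructor
  · rintro ⟨hp, ⟨x, w⟩, rfl⟩
    refine ⟨(x, w), ?_, rfl⟩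
    rintro (rfl : w = 0)
    exact hp ⟨x, (ν.coe_apply_zero x).symm⟩
  · rintro ⟨⟨x, w⟩, hw, rfl⟩
    exact ⟨ν.apply_mem_compl_range hw, mem_range_self _⟩

/-- `S¹ × (ℝ² ∖ 0)` is preconnected (`S¹` and the punctured plane are connected). [folklore] -/
theorem isPreconnected_compl_zeroSection :
    IsPreconnected {q : Metric.sphere (0 : EuclideanSpace ℝ (Fin 2)) 1 × EuclideanSpace ℝ (Fin 2) |
      q.2 ≠ 0} := by
  have hset : {q : Metric.sphere (0 : EuclideanSpace ℝ (Fin 2)) 1 × EuclideanSpace ℝ (Fin 2) |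
      q.2 ≠ 0} = univ ×ˢ {0}ᶜ := by
    ext q
    simp
  rw [hset]
  haveI : PreconnectedSpace (Metric.sphere (0 : EuclideanSpace ℝ (Fin 2)) 1) :=
    Subtype.preconnectedSpace (isPreconnected_sphere (one_lt_rank_euclideanSpace one_lt_two) _ _)
  exact isPreconnected_univ.prod
    (isConnected_compl_singleton_of_one_lt_rank
      (one_lt_rank_euclideanSpace one_lt_two) _).isPreconnected

/-- **A knot with a tubular neighbourhood does not separate `S³`**: `S³ ∖ K` is preconnected,
since `S³ = (S³ ∖ K) ∪ ν(S¹ × ℝ²)` is a cover of the connected `S³` by two open sets with connected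
intersection `ν(S¹ × (ℝ² ∖ 0))` (`IsPreconnected.of_isOpen_cover`). Cf. Rolfsen (1976), §3.A;
proved here (same argument as `TwoKnot.TubularNbhd.isPathConnected_compl_range`). [folklore] -/
theorem isPreconnected_compl_range (ν : Knot.TubularNbhd K) : IsPreconnected (range ⇑K)ᶜ := by
  haveI : PreconnectedSpace (Metric.sphere (0 : EuclideanSpace ℝ (Fin 4)) 1) :=
    Subtype.preconnectedSpace
      (isPreconnected_sphere (one_lt_rank_euclideanSpace (by norm_num)) _ _)
  have hcov : (range ⇑K)ᶜ ∪ range ⇑ν = univ := by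
    refine eq_univ_of_forall fun a ↦ ?_
    by_cases ha : a ∈ range ⇑K
    · exact Or.inr (ν.range_subset_range ha)
    · exact Or.inl ha
  refine IsPreconnected.of_isOpen_cover K.isClosed_range.isOpen_compl ν.isOpen_range hcov ?_
  rw [ν.compl_range_inter_range]
  exact isPreconnected_compl_zeroSection.image _ ν.continuous.continuousOn

/-- **The complement of a knot with a tubular neighbourhood is path connected**: `S³ ∖ K` is
open, connected (`isPreconnected_compl_range`), nonempty (`ν.basePoint`), and `S³` is locally path
connected. Cf. Rolfsen (1976), §3.A; proved here. [folklore] -/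
theorem isPathConnected_compl_range (ν : Knot.TubularNbhd K) : IsPathConnected (range ⇑K)ᶜ := by
  haveI : LocallyPathConnectedSpace (Metric.sphere (0 : EuclideanSpace ℝ (Fin 4)) 1) :=
    ChartedSpace.locallyPathConnectedSpace (EuclideanSpace ℝ (Fin 3)) _
  rw [← K.isClosed_range.isOpen_compl.isConnected_iff_isPathConnected]
  exact ⟨⟨ν.basePoint, ν.basePoint.2⟩, ν.isPreconnected_compl_range⟩

/-- The knot complement `K.complement`, as a space, is path connected (for a knot with an
oriented tubular neighbourhood). Cf. Rolfsen (1976), §3.A; proved here. [folklore] -/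
theorem pathConnectedSpace_complement (ν : Knot.TubularNbhd K) : PathConnectedSpace K.complement :=
  isPathConnected_iff_pathConnectedSpace.1 ν.isPathConnected_compl_range

end Knot.TubularNbhd

/-- **The complement of a knot in `S³` is path connected** — discharge of the named fact
`Knot.pathConnectedSpace_complement` of `Literature.Topology.FourManifolds.KnotGroup`: every knot
has an oriented tubular neighbourhood (`Knot.nonempty_tubularNbhd_holds`, Hirsch (1976), §4.5
Thm 5.2), and then `Knot.TubularNbhd.pathConnectedSpace_complement` applies. Rolfsen (1976), §3.A.
[cite: Rolfsen1976, §3.A] -/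
theorem Knot.pathConnectedSpace_complement_holds : Knot.pathConnectedSpace_complement := fun K ↦
  (Knot.nonempty_tubularNbhd_holds K).elim fun ν ↦ ν.pathConnectedSpace_complement

/-! ### A bounding disc contracts the loop of `J` in `S³ ∖ K` -/

namespace Knot

variable {K J : Knot} (h : Disjoint (range ⇑K) (range ⇑J))

/-- A convex combination of two points of the unit circle lies in the closed unit disc.
[folklore] -/
theorem convexCombo_mem_closedBall (u v : Metric.sphere (0 : EuclideanSpace ℝ (Fin 2)) 1)
    (s : unitInterval) :
    (1 - (s : ℝ)) • (u : EuclideanSpace ℝ (Fin 2)) + (s : ℝ) • (v : EuclideanSpace ℝ (Fin 2)) ∈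
      Metric.closedBall (0 : EuclideanSpace ℝ (Fin 2)) 1 :=
  convex_closedBall (0 : EuclideanSpace ℝ (Fin 2)) 1 (Metric.sphere_subset_closedBall u.2)
    (Metric.sphere_subset_closedBall v.2) (sub_nonneg.2 s.2.2) s.2.1 (sub_add_cancel 1 _)

/-- **A bounding disc contracts the loop of `J`.** If `f : ℝ² → S³` is continuous on the closed
unit disc, restricts to `J` on the unit circle and misses `K` on the closed disc, then the loop of
`J` is null-homotopic (rel base point) in `S³ ∖ K`: `(s, θ) ↦ f ((1 - s) e^{2πiθ} + s · 1)` — the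
image under `f` of the straight-line homotopy, inside the convex disc, from the boundary circle to
the constant loop at `1` — is a homotopy of loops in `S³ ∖ K` from the loop of `J` to the constant
loop at `J (1, 0)`. Rolfsen (1976), §5.D (2). [cite: Rolfsen1976, §5.D] -/
theorem homotopic_loopInCompl_refl
    (hdisc : ∃ f : EuclideanSpace ℝ (Fin 2) → Metric.sphere (0 : EuclideanSpace ℝ (Fin 4)) 1,
      ContinuousOn f (Metric.closedBall 0 1) ∧
      (∀ u : Metric.sphere (0 : EuclideanSpace ℝ (Fin 2)) 1, f u = J u) ∧
      ∀ x ∈ Metric.closedBall (0 : EuclideanSpace ℝ (Fin 2)) 1, f x ∉ range ⇑K) :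
    (K.loopInCompl J h).Homotopic (Path.refl _) := by
  obtain ⟨f, hf, hfJ, hfK⟩ := hdisc
  exact ⟨{
    toFun p := ⟨f ((1 - (p.1 : ℝ)) • (circlePoint (2 * Real.pi * p.2) : EuclideanSpace ℝ (Fin 2)) +
        (p.1 : ℝ) • (circlePoint 0 : EuclideanSpace ℝ (Fin 2))),
      (SphereEmbedding.mem_complement_iff _ _).2 (hfK _ (convexCombo_mem_closedBall _ _ p.1))⟩
    continuous_toFun := by
      refine Continuous.subtype_mk ?_ _
      refine hf.comp_continuous ?_ fun p ↦ convexCombo_mem_closedBall _ _ p.1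
      fun_prop
    map_zero_left θ := by
      apply Subtype.ext
      simp [hfJ]
    map_one_left θ := by
      apply Subtype.ext
      simp [hfJ]
    prop' s θ hθ := by
      apply Subtype.ext
      have hθ' : circlePoint (2 * Real.pi * θ) = circlePoint 0 := by
        rcases hθ with rfl | rfl
        · rw [Set.Icc.coe_zero, mul_zero]
        · rw [Set.Icc.coe_one, mul_one, ← zero_add (2 * Real.pi), circlePoint_add_two_pi]
      simp only [ContinuousMap.coe_mk, Path.coe_toContinuousMap, coe_loopInCompl_apply, hθ',
        ← add_smul, sub_add_cancel, one_smul, hfJ] }⟩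

/-- **A null-homotopic loop has linking number zero, for every choice of `(ν, γ)`**: if the loop of
`J` is null-homotopic in `S³ ∖ K`, then for every tubular neighbourhood `ν` of `K` and every path
`γ` from `ν.basePoint` to `J (1, 0)` the class of `γ · J · γ⁻¹` in `π₁(S³ ∖ K, ν.basePoint)ᵃᵇ`
is trivial, i.e. the `0`-th power of the class of the meridian
(`γ · J · γ⁻¹ ≃ γ · γ⁻¹ ≃ const`). Rolfsen (1976), §5.D (2). [cite: Rolfsen1976, §5.D] -/
theorem HasLinkingNumber.of_homotopic_refl (hJ : (K.loopInCompl J h).Homotopic (Path.refl _))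
    (ν : Knot.TubularNbhd K)
    (γ : Path ν.basePoint ⟨J (circlePoint 0), mem_complement_of_disjoint h _⟩) :
    Abelianization.of (FundamentalGroup.fromPath
        (Path.Homotopic.Quotient.mk ((γ.trans (K.loopInCompl J h)).trans γ.symm))) =
      Abelianization.of (FundamentalGroup.fromPath (Path.Homotopic.Quotient.mk ν.meridian)) ^
        (0 : ℤ) := by
  have htriv : ((γ.trans (K.loopInCompl J h)).trans γ.symm).Homotopic (Path.refl _) :=
    (((Path.Homotopic.hcomp (Path.Homotopic.hcomp (Path.Homotopic.refl γ) hJ)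
      (Path.Homotopic.refl γ.symm)).trans
      (Path.Homotopic.hcomp (Path.Homotopic.trans_refl γ) (Path.Homotopic.refl γ.symm))).trans
      (Path.Homotopic.trans_symm γ))
  rw [Path.Homotopic.Quotient.eq.2 htriv, zpow_zero]
  rfl

/-- **`lk(K, J) = 0` for `J` bounding a disc missing `K`, given a tubular neighbourhood of `K`.**
With `ν` an oriented tubular neighbourhood of `K`: `S³ ∖ K` is path connected
(`Knot.TubularNbhd.pathConnectedSpace_complement`), so there is a path `γ` from `ν.basePoint` to
`J (1, 0)`, and the class of `γ · J · γ⁻¹` is trivial by `HasLinkingNumber.of_homotopic_refl` and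
`homotopic_loopInCompl_refl`. Rolfsen (1976), §5.D (definition (2)). [cite: Rolfsen1976, §5.D] -/
theorem hasLinkingNumber_zero_of_exists_disc_of_tubularNbhd (K J : Knot)
    (h : Disjoint (range ⇑K) (range ⇑J)) (ν : Knot.TubularNbhd K)
    (hdisc : ∃ f : EuclideanSpace ℝ (Fin 2) → Metric.sphere (0 : EuclideanSpace ℝ (Fin 4)) 1,
      ContinuousOn f (Metric.closedBall 0 1) ∧
      (∀ u : Metric.sphere (0 : EuclideanSpace ℝ (Fin 2)) 1, f u = J u) ∧
      ∀ x ∈ Metric.closedBall (0 : EuclideanSpace ℝ (Fin 2)) 1, f x ∉ range ⇑K) :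
    K.HasLinkingNumber J h 0 := by
  haveI := ν.pathConnectedSpace_complement
  exact ⟨ν, PathConnectedSpace.somePath _ _,
    HasLinkingNumber.of_homotopic_refl h (homotopic_loopInCompl_refl h hdisc) ν _⟩

/-- **A knot bounding a disc in the complement has linking number zero** — discharge of the named
fact `Knot.hasLinkingNumber_zero_of_exists_disc`: if `J` extends to a continuous map of the closed
unit disc into `S³ ∖ K`, then `lk(K, J) = 0`. The tubular neighbourhood of `K` required by the
definition of `HasLinkingNumber` exists by `Knot.nonempty_tubularNbhd_holds` (Hirsch (1976), §4.5
Thm 5.2); then `hasLinkingNumber_zero_of_exists_disc_of_tubularNbhd`. Rolfsen (1976), §5.D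
(definition (2): a loop null-homotopic in `S³ ∖ K` is null-homologous there).
[cite: Rolfsen1976, §5.D] -/
theorem hasLinkingNumber_zero_of_exists_disc_holds : hasLinkingNumber_zero_of_exists_disc :=
  fun K J h hdisc ↦ (Knot.nonempty_tubularNbhd_holds K).elim fun ν ↦
    hasLinkingNumber_zero_of_exists_disc_of_tubularNbhd K J h ν hdisc

end Knot

/-! ### The push-off is a smooth embedding -/

namespace Knot.TubularNbhd

variable {K : Knot} (ν : Knot.TubularNbhd K)

/-- **The push-off is an immersion at every point** (with complement `ℝ²`). The recentred tubular
neighbourhood `Φ : (x, w) ↦ ν (x, w + e₀)` is an open partial homeomorphism `S¹ × ℝ² ⇀ S³`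
(source `univ`, target the open tube `ν (S¹ × ℝ²)`), `C^∞` with `C^∞` inverse
(`Literature.Topology.FourManifolds.contMDiffOn_symm_of_isSmoothEmbedding`), and the push-off
`x ↦ ν (x, e₀)` is its zero section, so the zero-section criterion
`Literature.Topology.FourManifolds.isImmersionAtOfComplement_of_eventuallyEq_prod` applies, the model
vector spaces `ℝ¹ × ℝ²` and `ℝ³` being identified by any linear isomorphism (equal dimension).
Hirsch (1976), Ch. 1 §3 (with Ch. 1 §2, `T(g ∘ f) = Tg ∘ Tf`). [cite: Hirsch1976, Ch. 1 §3] -/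
theorem isImmersionAtOfComplement_pushOff (x : Metric.sphere (0 : EuclideanSpace ℝ (Fin 2)) 1) :
    Manifold.IsImmersionAtOfComplement (EuclideanSpace ℝ (Fin 2)) (𝓡 1) (𝓡 3) ∞
      (fun y : Metric.sphere (0 : EuclideanSpace ℝ (Fin 2)) 1 ↦ ν (y, framingBaseVector)) x := by
  haveI : Nonempty (Metric.sphere (0 : EuclideanSpace ℝ (Fin 2)) 1 × EuclideanSpace ℝ (Fin 2)) :=
    ⟨(x, 0)⟩
  have ho : Topology.IsOpenEmbedding ⇑ν := ⟨ν.isSmoothEmbedding_coe.isEmbedding, ν.isOpen_range⟩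
  -- the fibre translation `(y, w) ↦ (y, w + e₀)` and the recentred tubular neighbourhood `Φ`
  set T : (Metric.sphere (0 : EuclideanSpace ℝ (Fin 2)) 1 × EuclideanSpace ℝ (Fin 2)) ≃ₜ
      (Metric.sphere (0 : EuclideanSpace ℝ (Fin 2)) 1 × EuclideanSpace ℝ (Fin 2)) :=
    (Homeomorph.refl _).prodCongr (Homeomorph.addRight framingBaseVector) with hTdef
  set Φ : OpenPartialHomeomorph
      (Metric.sphere (0 : EuclideanSpace ℝ (Fin 2)) 1 × EuclideanSpace ℝ (Fin 2))
      (Metric.sphere (0 : EuclideanSpace ℝ (Fin 4)) 1) :=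
    T.transOpenPartialHomeomorph (ho.toOpenPartialHomeomorph ⇑ν) with hΦdef
  have hΦ_apply : ∀ q, Φ q = ν (q.1, q.2 + framingBaseVector) := fun q ↦ rfl
  have hΦ_source : Φ.source = univ := by
    rw [hΦdef, Homeomorph.transOpenPartialHomeomorph_source,
      Topology.IsOpenEmbedding.toOpenPartialHomeomorph_source, preimage_univ]
  have hΦ_target : Φ.target = range ⇑ν := by
    rw [hΦdef, Homeomorph.transOpenPartialHomeomorph_target,
      Topology.IsOpenEmbedding.toOpenPartialHomeomorph_target]
  -- `Φ` is smooth, with smooth inverse on the open tube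
  have hT : ContMDiff ((𝓡 1).prod 𝓘(ℝ, EuclideanSpace ℝ (Fin 2)))
      ((𝓡 1).prod 𝓘(ℝ, EuclideanSpace ℝ (Fin 2))) ∞ ⇑T :=
    (contMDiff_fst.prodMk (contMDiff_snd.add contMDiff_const)).congr fun q ↦ rfl
  have hTsymm : ContMDiff ((𝓡 1).prod 𝓘(ℝ, EuclideanSpace ℝ (Fin 2)))
      ((𝓡 1).prod 𝓘(ℝ, EuclideanSpace ℝ (Fin 2))) ∞ ⇑T.symm :=
    (contMDiff_fst.prodMk (contMDiff_snd.add contMDiff_const)).congr fun q ↦ rfl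
  have hΦ : ContMDiffOn ((𝓡 1).prod 𝓘(ℝ, EuclideanSpace ℝ (Fin 2))) (𝓡 3) ∞ Φ Φ.source :=
    ((ν.contMDiff.comp hT).congr fun q ↦ hΦ_apply q).contMDiffOn
  have hΦ' : ContMDiffOn (𝓡 3) ((𝓡 1).prod 𝓘(ℝ, EuclideanSpace ℝ (Fin 2))) ∞ Φ.symm Φ.target := by
    rw [hΦ_target]
    exact hTsymm.comp_contMDiffOn (contMDiffOn_symm_of_isSmoothEmbedding ν.isSmoothEmbedding_coe ho)
  -- equal dimensions: `ℝ¹ × ℝ² ≃L ℝ³`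
  have hdim : Module.finrank ℝ (EuclideanSpace ℝ (Fin 1) × EuclideanSpace ℝ (Fin 2)) =
      Module.finrank ℝ (EuclideanSpace ℝ (Fin 3)) := by
    simp
  refine isImmersionAtOfComplement_of_eventuallyEq_prod Φ hΦ hΦ'
    (ContinuousLinearEquiv.ofFinrankEq hdim) (by rw [hΦ_source]; exact mem_univ _)
    (Filter.Eventually.of_forall fun y ↦ ?_)
  change ν (y, framingBaseVector) = Φ (y, 0)
  rw [hΦ_apply, zero_add]

/-- **The push-off is an immersion** `S¹ → S³` (complement `ℝ²` at every point,
`isImmersionAtOfComplement_pushOff`). Hirsch (1976), Ch. 1 §3. [cite: Hirsch1976, Ch. 1 §3] -/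
theorem isImmersion_pushOff : Manifold.IsImmersion (𝓡 1) (𝓡 3) ∞
    (fun y : Metric.sphere (0 : EuclideanSpace ℝ (Fin 2)) 1 ↦ ν (y, framingBaseVector)) :=
  Manifold.IsImmersionOfComplement.isImmersion (F := EuclideanSpace ℝ (Fin 2)) fun x ↦
    ν.isImmersionAtOfComplement_pushOff x

/-- **The push-off is a topological embedding**: a continuous injection (`ν` is injective) of the
compact circle into the Hausdorff `S³`. Hirsch (1976), Ch. 1 §3 (an injective immersion of a
compact manifold is an embedding, Exercise 1). [cite: Hirsch1976, Ch. 1 §3] -/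
theorem isEmbedding_pushOff : Topology.IsEmbedding
    (fun y : Metric.sphere (0 : EuclideanSpace ℝ (Fin 2)) 1 ↦ ν (y, framingBaseVector)) :=
  (Continuous.isClosedEmbedding (by fun_prop) fun y y' h ↦
    congrArg Prod.fst (ν.injective h)).isEmbedding

/-- **The push-off of a knot along an oriented tubular neighbourhood is a smooth embedding** —
discharge of the named fact `Knot.TubularNbhd.isSmoothEmbedding_pushOff` of
`Literature.Topology.FourManifolds.LinkingNumber`: `x ↦ ν (x, e₀)` is a `C^∞` immersion
(`isImmersion_pushOff`: zero section of the recentred open tubular neighbourhood, an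
equidimensional open smooth embedding with smooth inverse) and a topological embedding
(`isEmbedding_pushOff`). Hirsch, *Differential Topology* (1976), Ch. 1 §3 (definition of an
embedding: an immersion mapping its domain homeomorphically onto its image; Thm. 3.1), with
Ch. 1 §2 (`T(g ∘ f) = Tg ∘ Tf`) for the composite `ν ∘ (x ↦ (x, e₀))`; Rolfsen (1976), §9.F
(longitudes). [cite: Hirsch1976, Ch. 1 §3] -/
theorem isSmoothEmbedding_pushOff_holds : isSmoothEmbedding_pushOff := fun ν ↦
  ⟨ν.isImmersion_pushOff, ν.isEmbedding_pushOff⟩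

end Knot.TubularNbhd

end Literature.Topology.FourManifolds
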